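import Summits.ABC.IUTFork.Joshi.WittPrimitiveAnsatzFrobeniusOrbit
import Literature.NumberTheory.PAdicHodge.FontaineThetaKernel
import Mathlib.RingTheory.WittVector.DiscreteValuationRing
import Mathlib.RingTheory.WittVector.MulCoeff
import HarnessLib

/-!
# [J-IIp] Prop. 6.2.1 (2) and Lemma 6.2.2 DISCHARGED AT THE STANDARD POINT: over the genuine tilt `𝒪_{ℂ_F}♭` Joshi's ideal
# `𝔭_1 = ([p♭] − p)` IS the kernel of Fontaine's `θ`, hence PRIME, and every primitive element of degree one over that
# untilt generates it (proof-only companion of `Joshi/WittPrimitiveElements.lean`, block E, seat abc-iut-E-t62)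

Proof-only companion (abc-iut cell, block E «type Joshi's construction, test vs S», rung LADDER-ABC:A2.E; seat abc-iut-E-t62,
§4-fallback «DERIVABLE rows of one's own landed file») of `Joshi/WittPrimitiveElements.lean` (p434913; J2p rows Prop6.2.1(1)(2)(4),
Lem6.2.2, Rmk6.6.2) and of abc-iut-E-t2's sequel `Joshi/WittPrimitiveAnsatzFrobeniusOrbit.lean` (p442065: the `Φ^ℤ`-orbit, the printed
fibre `frobeniusFibre p t = {([φⁿ(t)] − p) : n ∈ ℤ}` of §6.6 — consumed BY NAME, nothing re-proved), both typing K. Joshi, *Construction of Arithmetic Teichmüller Spaces II: Proof of a local prototype of Mochizuki's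
Corollary 3.12*, arXiv:2303.01662v3 = [J-IIp], `paper:arxiv-2303.01662`; render `HOME/lit/renders/Joshi-arxiv-2303.01662/pNNNN.txt`,
«p. N l. M» = line M of page N). That file typed §6.2 over Mathlib's `WittVector p 𝒪` for an ABSTRACT ring `𝒪` of characteristic `p`
and left two sentences as claim-`Prop`s because the untilt `W(𝒪_F)/([a] − p)` is not in Mathlib:
* `Witt.Prop621PrimeClaim` — Prop. 6.2.1 (2), p. 14 l. 57–59: «each of these elements generates a principal PRIME ideal
  `𝔭_j = ([a^{j²}] − p)`» (proof p. 15 l. 6–14 via [FF18, Lem. 2.2.14]);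
* `Witt.Lem622` — Lemma 6.2.2, p. 15 l. 15–26: «a principal ideal generated by a primitive element of degree one is `𝔭_1` of such a
  tuple» (via [FF18, Cor. 2.2.9] `α·u = [a] − p`).

WHAT IS DISCHARGED HERE, AND WHERE. Joshi's `F` is `ℂ_p♭` and `𝒪_F = 𝒪_{ℂ_p}♭` (p. 14 l. 47–52; §6.1). That ring IS in the tree:
`PreTilt (integerC F) p` = `𝒪_{ℂ_F}♭` for any `p`-adic local field `F` (Joshi: `F = ℚ_p`), with Fontaine's
`θ : 𝔸_inf(F) = 𝕎(𝒪_{ℂ_F}♭) → 𝒪_{ℂ_F}` (Mathlib `fontaineTheta`), the element `p♭ = (p, p^{1/p}, …)` (`pFlat`), `ξ = [p♭] − p` (`xi`)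
and the structure theorem **`ker θ = (ξ)`** (`Literature.NumberTheory.PAdicHodge.ker_fontaineTheta_eq_span_xi`, Fontaine, Astérisque
223 Exp. II Prop. 1.2.3) — all consumed BY NAME. Over this genuine carrier:
1. `teichSubP_pFlat` : Joshi's `[a] − p` at `a = p♭` is Fontaine's `ξ` (definitionally), so `𝔭_1(p♭) = ker θ`
   (`jIdeal_pFlat_zero_eq_ker`); **Prop. 6.2.1 (2)'s primality clause HOLDS at the standard point** `(j, a) = (1, p♭)`:
   `isPrime_jIdeal_pFlat_zero` (the quotient is `𝒪_{ℂ_F}`, a domain: `nonempty_quotient_jIdeal_pFlat_equiv`) — this is the point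
   `y` of `Y_{F,ℚ_p}` whose untilt `K_y` is `ℂ_F` itself — §6.5's CANONICAL point, now identified inside `𝕎(𝒪_{ℂ_F}♭)` (E-t2's file had to
   leave «WHICH `t` is canonical» open); and along its whole Frobenius orbit `a = φⁿ(p♭)`, `n ∈ ℤ`: **every member of the printed
   fibre `frobeniusFibre p p♭ = {([φⁿ(p♭)] − p) : n ∈ ℤ}` over the canonical point (§6.6 p. 16 l. 30–41 «the set of prime ideals
   generated by primitive irreducible elements of degree one») IS PRIME** (`isPrime_of_mem_frobeniusFibre_pFlat`,
   `isPrime_span_teichSubP_frobeniusEquiv_zpow_pFlat`, `isPrime_span_teichSubP_pFlat_pow`; its `n = 0` member is `ker θ`,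
   `ker_fontaineTheta_mem_frobeniusFibre_pFlat`; Prop. 6.2.1 (4) / Prop. 6.6.1), in
   particular at the tuple entries `j = p^m` of `a = p♭` (`isPrime_jIdeal_pFlat_of_eq_pow`, since `[a^{(p^m)²}] − p = φ^{2m}([a] − p)`,
   `ansatzTuple_eq_frobenius_iterate` — an identity valid for every `a`: the entries `y_1` and `y_{p^m}` of Def. 6.2.3's tuple lie
   in ONE `φ^ℤ`-orbit, i.e. over one point of `X = Y/φ^ℤ`, while being distinct in `Y`, `Witt.jIdeal_injective`).
2. **Lemma 6.2.2 HOLDS for the primitive elements lying over the standard untilt**: an element of `ker θ` whose first Witt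
   coordinate is a unit generates `ker θ` (`span_eq_ker_of_isUnit_coeff_one`; the Witt-vector identity
   `(x·y)₁ = x₁ y₀^p + y₁ x₀^p`, `mul_coeff_one`, and «a Witt vector / an element of a perfection with unit zeroth coordinate is a
   unit», `isUnit_of_isUnit_coeff_zero`, `preTilt_isUnit_of_isUnit_coeff_zero`), so every `IsPrimitiveDegOne p 𝔪 x` with `θ(x) = 0`
   satisfies the BODY of `Witt.Lem622` with witness `a = p♭`, and `p♭ ∈ 𝔪` is forced (`lem622_of_mem_ker_fontaineTheta`).
3. Boundary of the typed predicate (a test of OUR typing, not of print): `¬ Witt.Prop621PrimeClaim p ⊤ ℓ⋆` for `ℓ⋆ ≥ 1` over any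
   non-trivial perfect ring (`a = 1` gives `[1] − p = 1 − p`, a unit of the `p`-adically complete `𝕎`) — the binder `a ∈ 𝔪` with `𝔪`
   PROPER is load-bearing; Joshi's `𝔪_F` is the maximal ideal, so nothing printed is affected.
NOT discharged (honest scope): primality of `([a] − p)` when this ideal is not a `φ^ℤ`-translate of `ker θ`, and Lemma 6.2.2 for
primitive elements OUTSIDE `ker θ` — these are the OTHER untilts `K_y ≠ ℂ_F` of [FF18, §2.2] (Lem. 2.2.14 / Cor. 2.2.9; cf. Thm. 6.9.1 (4) «need not be topologically
isomorphic», [Kedlaya–Temkin]), whose construction is not in Mathlib; they remain the claim-`Prop` / the hypothesis binder `hFF` of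
`Witt.lem622_of_cor229`. No new `def … : Prop`, no instance, no notation, no FACT-LIST input, no `Cor312*`/`Thm311*` import (R14);
nothing here bears on S. TYPED AS A CANDIDATE (D-0012): typed ≠ proved ≠ endorsed; **no side is taken** on [IUTchIII] Cor. 3.12, on
Joshi's claims or on Mochizuki's report on them. [claim: Joshi2023ATS2Local, status: disputed]
-/

noncomputable section

namespace Summit.ABC.IUTFork.Joshi.Witt

open WittVector

/-! ## 1. Witt-vector arithmetic: the first coordinate of a product; units; the `𝔪 = ⊤` boundary; the `p^m`-th tuple entry -/

section WittArithmetic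

variable (p : ℕ) [hp : Fact p.Prime] {k : Type*} [CommRing k] [CharP k p]

/-- **`(x·y)₁ = x₁·y₀^p + y₁·x₀^p`** in `𝕎(k)`, `k` of characteristic `p` (the ghost component `w₁ = X₀^p + p X₁` is multiplicative and
the cross term `p·x₁y₁` dies in characteristic `p`). Obtained from Mathlib's `nthRemainder_spec` at `n = 0`: its remainder depends
only on the zeroth coordinates, and vanishes on Teichmüller lifts. [folklore] -/
theorem mul_coeff_one (x y : WittVector p k) : (x * y).coeff 1 = x.coeff 1 * y.coeff 0 ^ p + y.coeff 1 * x.coeff 0 ^ p := by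
  have key : ∀ x y : WittVector p k, nthRemainder p 0 (truncateFun (0 + 1) x) (truncateFun (0 + 1) y) = 0 := by
    intro x y
    have htr : ∀ z : WittVector p k, truncateFun (0 + 1) z = truncateFun (0 + 1) (teichmuller p (z.coeff 0)) := fun z => by
      refine TruncatedWittVector.ext fun i => ?_
      rw [coeff_truncateFun, coeff_truncateFun]
      have hi : (i : ℕ) = 0 := by omega
      rw [hi, teichmuller_coeff_zero]
    rw [htr x, htr y]
    have h := nthRemainder_spec p 0 (teichmuller p (x.coeff 0)) (teichmuller p (y.coeff 0))
    rw [← map_mul (teichmuller p), teichmuller_coeff_pos p _ (0 + 1) (Nat.succ_pos 0),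
      teichmuller_coeff_pos p _ (0 + 1) (Nat.succ_pos 0), teichmuller_coeff_pos p _ (0 + 1) (Nat.succ_pos 0), zero_mul,
      zero_mul, zero_add, zero_add] at h
    exact h.symm
  have h := nthRemainder_spec p 0 x y
  rw [key, add_zero] at h
  simpa using h

/-- First coordinate of a multiple of Joshi's element: **`(([a] − p)·w)₁ = (−1)^p·w₀^p + w₁·a^p`**. [folklore] -/
theorem coeff_one_teichSubP_mul (a : k) (w : WittVector p k) :
    (teichSubP p a * w).coeff 1 = (-1 : k) ^ p * w.coeff 0 ^ p + w.coeff 1 * a ^ p := by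
  rw [mul_coeff_one, coeff_one_teichSubP, coeff_zero_teichSubP]

/-- Zeroth coordinate of a multiple: `(([a] − p)·w)₀ = a·w₀`. [folklore] -/
theorem coeff_zero_teichSubP_mul (a : k) (w : WittVector p k) : (teichSubP p a * w).coeff 0 = a * w.coeff 0 := by
  rw [WittVector.mul_coeff_zero, coeff_zero_teichSubP]

omit [CharP k p] in
/-- **A Witt vector whose zeroth coordinate is a unit is a unit** (`k` any commutative ring of characteristic `p`; Mathlib's
`WittVector.mkUnit` constructs the inverse — its `isUnit_of_coeff_zero_ne_zero` is the field case). [folklore] -/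
theorem isUnit_of_isUnit_coeff_zero [CharP k p] {w : WittVector p k} (h : IsUnit (w.coeff 0)) : IsUnit w := by
  obtain ⟨u, hu⟩ := h
  rw [← coe_mkUnit (p := p) (a := u) (A := w) hu.symm]
  exact Units.isUnit _

/-- **An element of the tilt `𝒪♭ = PreTilt 𝒪 p` whose image in `𝒪/p` is a unit is a unit**: all its coordinates `x_n`
(`x_{n+1}^p = x_n`) are then units, and `(x_n⁻¹)_n` is again a compatible sequence. [folklore] -/
theorem preTilt_isUnit_of_isUnit_coeff_zero {O : Type*} [CommRing O] [Fact (¬ IsUnit (p : O))] {x : PreTilt O p}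
    (h : IsUnit (PreTilt.coeff 0 x)) : IsUnit x := by
  have hn : ∀ n, IsUnit (PreTilt.coeff n x) := by
    intro n
    induction n with
    | zero => exact h
    | succ n ih => exact (isUnit_pow_iff hp.out.ne_zero).1 (by rwa [PreTilt.coeff_pow_p])
  choose u hu using hn
  have hup : ∀ n, u (n + 1) ^ p = u n := fun n =>
    Units.ext (by rw [Units.val_pow_eq_pow_val, hu, hu, PreTilt.coeff_pow_p])
  let y : PreTilt O p := ⟨fun n => (((u n)⁻¹ : (ModP O p)ˣ) : ModP O p), fun n => by
    change ((((u (n + 1))⁻¹ : (ModP O p)ˣ)) : ModP O p) ^ p = (((u n)⁻¹ : (ModP O p)ˣ) : ModP O p)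
    rw [← Units.val_pow_eq_pow_val, inv_pow, hup]⟩
  refine isUnit_iff_exists_inv.2 ⟨y, Subtype.ext <| funext fun n => ?_⟩
  change PreTilt.coeff n x * (((u n)⁻¹ : (ModP O p)ˣ) : ModP O p) = 1
  rw [← hu n, Units.mul_inv]

/-- **`[1] − p = 1 − p` is a UNIT of `𝕎(k)`** for `k` perfect of characteristic `p` (`𝕎(k)` is `p`-adically complete, Mathlib
`WittVector.isAdicCompleteIdealSpanP`, so `p` lies in the Jacobson radical). [folklore] -/
theorem isUnit_teichSubP_one [PerfectRing k p] : IsUnit (teichSubP p (1 : k)) := by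
  rw [teichSubP, map_one]
  have h := Ideal.mem_jacobson_bot.1
    (IsAdicComplete.le_jacobson_bot (Ideal.span {(p : WittVector p k)}) (Ideal.mem_span_singleton_self _)) (-1)
  have e : (1 : WittVector p k) - p = (p : WittVector p k) * -1 + 1 := by ring
  rw [e]; exact h

/-- **Boundary of the typed predicate `Witt.Prop621PrimeClaim` (a test of OUR typing, not of print): at `𝔪 = ⊤` it FAILS** as soon as
`ℓ⋆ ≥ 1` (`k` perfect, non-trivial): `a = 1 ∈ ⊤ ∖ {0}` gives `𝔭_1 = (1 − p) = 𝕎(k)`, not a prime ideal. Joshi's `𝔪_F` is the maximal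
ideal of `𝒪_F`, so the printed claim is untouched; the binder «`a ∈ 𝔪`, `𝔪` proper» is load-bearing. [folklore] -/
theorem not_prop621PrimeClaim_top [PerfectRing k p] [Nontrivial k] {lstar : ℕ} (hl : 0 < lstar) :
    ¬ Prop621PrimeClaim p (⊤ : Ideal k) lstar := fun h => by
  refine (h 1 one_ne_zero Submodule.mem_top ⟨0, hl⟩).ne_top ?_
  rw [jIdeal, ansatzTuple_zero p hl, Ideal.span_singleton_eq_top]
  exact isUnit_teichSubP_one p

/-- **The `p^m`-th entry of Def. 6.2.3's tuple is the `2m`-th Frobenius iterate of the first**: `[a^{(p^m)²}] − p = φ^{2m}([a] − p)`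
(any `a`, any `k` of characteristic `p`). Hence `y_1` and `y_{p^m}` lie in one `φ^ℤ`-orbit of `Y_{F,ℚ_p}` — over ONE point of
`X = Y/φ^ℤ` (Prop. 6.2.1 (4), p. 15 l. 1–5) — although they are distinct points of `Y` (`Witt.jIdeal_injective`).
[claim: Joshi2023ATS2Local, status: disputed] -/
theorem ansatzTuple_eq_frobenius_iterate (lstar : ℕ) (a : k) {m : ℕ} (i : Fin lstar) (hi : (i : ℕ) + 1 = p ^ m) :
    ansatzTuple p lstar a i = (frobenius : WittVector p k →+* WittVector p k)^[2 * m] (teichSubP p a) := by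
  rw [frobenius_iterate_teichSubP, ansatzTuple, hi, ← pow_mul, Nat.mul_comm m 2]

/-- The corresponding ideals: `𝔭_{p^m}(a) = (φ^{2m}([a] − p))`. [claim: Joshi2023ATS2Local, status: disputed] -/
theorem jIdeal_eq_span_frobenius_iterate (lstar : ℕ) (a : k) {m : ℕ} (i : Fin lstar) (hi : (i : ℕ) + 1 = p ^ m) :
    jIdeal p lstar a i = Ideal.span {(frobenius : WittVector p k →+* WittVector p k)^[2 * m] (teichSubP p a)} := by
  rw [jIdeal, ansatzTuple_eq_frobenius_iterate p lstar a i hi]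

/-- A ring automorphism carries a principal prime ideal to a principal prime ideal. [folklore] -/
theorem isPrime_span_map_equiv {R : Type*} [CommRing R] (e : R ≃+* R) {x : R} (hx : (Ideal.span {x}).IsPrime) :
    (Ideal.span {e x}).IsPrime := by
  rw [← Set.image_singleton, ← Ideal.map_span]
  exact Ideal.map_isPrime_of_equiv e

/-- … and so do its iterates. [folklore] -/
theorem isPrime_span_iterate_equiv {R : Type*} [CommRing R] (e : R ≃+* R) {x : R} (hx : (Ideal.span {x}).IsPrime) (n : ℕ) :
    (Ideal.span {(⇑e)^[n] x}).IsPrime := by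
  induction n with
  | zero => simpa using hx
  | succ n ih => rw [Function.iterate_succ_apply']; exact isPrime_span_map_equiv e ih

end WittArithmetic

/-! ## 2. The standard point: `[p♭] − p = ξ`, `𝔭_1(p♭) = ker θ` is prime, and Lemma 6.2.2 on `ker θ` -/

section StandardPoint

open Literature.NumberTheory.PAdicHodge Literature.NumberTheory.GaloisRepresentations ValuativeRel

variable {F : Type} [Field F] [ValuativeRel F] [TopologicalSpace F] [IsNonarchimedeanLocalField F]
  {p : ℕ} [hp : Fact p.Prime] [Fact (¬ IsUnit (p : integerC F))]

/-- **Joshi's `[a] − p` at `a = p♭ ∈ 𝒪_{ℂ_F}♭` IS Fontaine's `ξ`** (definitionally: both are `teichmuller p p♭ − p`).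
[cite: FontaineAsterisque223III, Exp. II §1.2.2] -/
theorem teichSubP_pFlat : teichSubP p (pFlat : PreTilt (integerC F) p) = (xi : Ainf (p := p) F) := rfl

/-- The first entry of Def. 6.2.3's tuple at `a = p♭` is `ξ`. [claim: Joshi2023ATS2Local, status: disputed] -/
theorem ansatzTuple_pFlat_zero {lstar : ℕ} (hl : 0 < lstar) :
    ansatzTuple p lstar (pFlat : PreTilt (integerC F) p) ⟨0, hl⟩ = (xi : Ainf (p := p) F) := by
  rw [ansatzTuple_zero p hl]; rfl

/-- **`p♭` is not a unit of `𝒪_{ℂ_F}♭`** (its image `(p♭)₀ = p mod p = 0` in `𝒪_{ℂ_F}/p` is not), so it lies in the maximal ideal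
`𝔪_{ℂ_F♭}` = Joshi's `𝔪_F`. [folklore] -/
theorem not_isUnit_pFlat : ¬ IsUnit (pFlat : PreTilt (integerC F) p) := fun h => by
  have h0 := h.map (PreTilt.coeff (O := integerC F) (p := p) 0)
  rw [coeff_zero_pFlat] at h0
  exact not_isUnit_zero h0

/-- **If `(w·ξ)₁` is a unit then `w₀` is a unit of `𝒪_{ℂ_F}♭`**: `(w·ξ)₁ = w₁ (p♭)^p + (−1)^p w₀^p` and `(p♭)₀ = 0`, so the image of
`(w·ξ)₁` in `𝒪_{ℂ_F}/p` is `(−1)^p·(w₀)₀^p`; a unit there lifts (`preTilt_isUnit_of_isUnit_coeff_zero`). [folklore] -/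
theorem isUnit_coeff_zero_of_isUnit_mul_xi_coeff_one {w : Ainf (p := p) F}
    (h : IsUnit ((w * (xi : Ainf (p := p) F)).coeff 1)) : IsUnit (w.coeff 0) := by
  rw [mul_comm, ← teichSubP_pFlat, coeff_one_teichSubP_mul] at h
  have h0 := h.map (PreTilt.coeff (O := integerC F) (p := p) 0)
  rw [map_add, map_mul, map_mul, map_pow, map_pow, map_pow, coeff_zero_pFlat, zero_pow hp.out.ne_zero, mul_zero, add_zero,
    map_neg, map_one] at h0
  have h1 : IsUnit (PreTilt.coeff 0 (w.coeff 0) ^ p) := (IsUnit.mul_iff.1 h0).2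
  exact preTilt_isUnit_of_isUnit_coeff_zero p ((isUnit_pow_iff hp.out.ne_zero).1 h1)

/-- … hence `w` itself is a unit of `𝔸_inf(F)`. [folklore] -/
theorem isUnit_of_isUnit_mul_xi_coeff_one {w : Ainf (p := p) F} (h : IsUnit ((w * (xi : Ainf (p := p) F)).coeff 1)) :
    IsUnit w :=
  isUnit_of_isUnit_coeff_zero p (isUnit_coeff_zero_of_isUnit_mul_xi_coeff_one h)

variable [CharZero F]

/-- `ξ = [p♭] − p` is primitive of degree one with respect to every ideal containing `p♭` (in particular Joshi's `𝔪_F`):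
`Witt.isPrimitiveDegOne_teichSubP` at the genuine tilt. [claim: Joshi2023ATS2Local, status: disputed] -/
theorem isPrimitiveDegOne_xi (𝔪 : Ideal (PreTilt (integerC F) p)) (h𝔪 : (pFlat : PreTilt (integerC F) p) ∈ 𝔪) :
    IsPrimitiveDegOne p 𝔪 (xi : Ainf (p := p) F) :=
  isPrimitiveDegOne_teichSubP p 𝔪 pFlat_ne_zero h𝔪

/-- The ansatz tuple of `a = p♭` lies in `Σ̃_F` (as printed) for every `𝔪 ∋ p♭`. [claim: Joshi2023ATS2Local, status: disputed] -/
theorem ansatzTuple_pFlat_mem (𝔪 : Ideal (PreTilt (integerC F) p)) (h𝔪 : (pFlat : PreTilt (integerC F) p) ∈ 𝔪) (lstar : ℕ) :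
    ansatzTuple p lstar (pFlat : PreTilt (integerC F) p) ∈ primitiveAnsatzW p 𝔪 lstar :=
  ⟨pFlat, pFlat_ne_zero, h𝔪, rfl⟩

variable [IsAdicComplete (Ideal.span {(p : integerC F)}) (integerC F)]

/-- **`𝔭_1(p♭) = ([p♭] − p) = ker θ`**: Joshi's ideal of Prop. 6.2.1 (2) at `(j, a) = (1, p♭)` is the kernel of Fontaine's `θ`
(tree: `ker_fontaineTheta_eq_span_xi`). [cite: FontaineAsterisque223III, Exp. II Prop. 1.2.3] -/
theorem jIdeal_pFlat_zero_eq_ker {lstar : ℕ} (hl : 0 < lstar) :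
    jIdeal p lstar (pFlat : PreTilt (integerC F) p) ⟨0, hl⟩ = RingHom.ker (fontaineTheta (integerC F) p) := by
  rw [jIdeal, ansatzTuple_pFlat_zero hl, ker_fontaineTheta_eq_span_xi]

omit [CharZero F] in
/-- `ker θ` is a prime ideal of `𝔸_inf(F)` (`𝒪_{ℂ_F}` is a domain). [folklore] -/
theorem isPrime_ker_fontaineTheta : (RingHom.ker (fontaineTheta (integerC F) p)).IsPrime := RingHom.ker_isPrime _

/-- **Prop. 6.2.1 (2), PRIMALITY CLAUSE, DISCHARGED AT THE STANDARD POINT** (p. 14 l. 57–59 «a principal prime ideal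
`𝔭_j = ([a^{j²}] − p)`», here `j = 1`, `a = p♭ ∈ 𝔪_F ∖ {0}`): `𝔭_1(p♭)` is prime — it is `ker θ`. The instance of
`Witt.Prop621PrimeClaim p 𝔪 ℓ⋆` at this one parameter; the other parameters are other untilts ([FF18, Lem. 2.2.14], not in the tree).
[claim: Joshi2023ATS2Local, status: disputed] -/
theorem isPrime_jIdeal_pFlat_zero {lstar : ℕ} (hl : 0 < lstar) :
    (jIdeal p lstar (pFlat : PreTilt (integerC F) p) ⟨0, hl⟩).IsPrime := by
  rw [jIdeal_pFlat_zero_eq_ker hl]; exact isPrime_ker_fontaineTheta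

omit [IsAdicComplete (Ideal.span {(p : integerC F)}) (integerC F)] in
/-- **The untilt at the standard point is `ℂ_F`**: `𝕎(𝒪_{ℂ_F}♭)/𝔭_1(p♭) ≃ 𝒪_{ℂ_F}` (Joshi's `𝒪_{K_{y_1}}` for `a = p♭`; `θ` is surjective,
tree `surjective_fontaineTheta_integerC`). [cite: FontaineAsterisque223III, Exp. II §1.2] -/
theorem nonempty_quotient_jIdeal_pFlat_equiv (hp1 : valuation F p < 1) {lstar : ℕ} (hl : 0 < lstar) :
    Nonempty ((Ainf (p := p) F ⧸ jIdeal p lstar (pFlat : PreTilt (integerC F) p) ⟨0, hl⟩) ≃+* integerC F) :=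
  haveI := isAdicComplete_integerC_natCast (F := F) hp1
  ⟨(Ideal.quotEquivOfEq (jIdeal_pFlat_zero_eq_ker hl)).trans
    (RingHom.quotientKerEquivOfSurjective (surjective_fontaineTheta_integerC hp1))⟩

/-- **Primality along the Frobenius orbit of the standard point**: `(φⁿ(ξ)) = ([(p♭)^{pⁿ}] − p)` is prime for every `n ≥ 0`
(`φ` is an automorphism of `𝕎` of the perfect ring `𝒪_{ℂ_F}♭`; Prop. 6.2.1 (4) / Prop. 6.6.1: the points `φⁿ(y)`).
[claim: Joshi2023ATS2Local, status: disputed] -/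
theorem isPrime_span_frobenius_iterate_xi (n : ℕ) :
    (Ideal.span {(frobenius : Ainf (p := p) F →+* Ainf (p := p) F)^[n] (xi : Ainf (p := p) F)}).IsPrime := by
  have h := isPrime_span_iterate_equiv (WittVector.frobeniusEquiv p (PreTilt (integerC F) p))
    (x := (xi : Ainf (p := p) F)) (by rw [← ker_fontaineTheta_eq_span_xi]; exact isPrime_ker_fontaineTheta) n
  rwa [WittVector.frobeniusEquiv_apply] at h

/-- The same orbit written with Joshi's parameters: `([(p♭)^{pⁿ}] − p)` is prime, `n ≥ 0`. [claim: Joshi2023ATS2Local, status: disputed] -/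
theorem isPrime_span_teichSubP_pFlat_pow (n : ℕ) :
    (Ideal.span {teichSubP p ((pFlat : PreTilt (integerC F) p) ^ p ^ n)}).IsPrime := by
  rw [← frobenius_iterate_teichSubP, teichSubP_pFlat]; exact isPrime_span_frobenius_iterate_xi n

/-- **Every `Φⁿ`-translate of `ker θ`, `n ∈ ℤ`, is prime**: `(Φⁿ(ξ)) = ([φⁿ(p♭)] − p)` (`Φ = WittVector.frobeniusEquiv`, the Frobenius
AUTOMORPHISM of `𝕎(𝒪_{ℂ_F}♭)`, `φ = frobeniusEquiv 𝒪_{ℂ_F}♭ p`; E-t2's `frobeniusEquiv_zpow_teichSubP`). [claim: Joshi2023ATS2Local, status: disputed] -/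
theorem isPrime_span_teichSubP_frobeniusEquiv_zpow_pFlat (n : ℤ) :
    (Ideal.span {teichSubP p ((_root_.frobeniusEquiv (PreTilt (integerC F) p) p ^ n) (pFlat : PreTilt (integerC F) p))}).IsPrime := by
  rw [← frobeniusEquiv_zpow_teichSubP, teichSubP_pFlat]
  exact isPrime_span_map_equiv _ (by rw [← ker_fontaineTheta_eq_span_xi]; exact isPrime_ker_fontaineTheta)

/-- **§6.6 (p. 16 l. 30–41) at the genuine object: EVERY member of the printed fibre `{([φⁿ(t)] − p) : n ∈ ℤ}` over the canonical point
— E-t2's `frobeniusFibre p t` at the CANONICAL parameter `t = p♭` — IS A PRIME IDEAL of `𝕎(𝒪_{ℂ_F}♭)`** («the set of prime ideals generated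
by primitive irreducible elements of degree one»), and its `n = 0` member is `ker θ` (`ker_fontaineTheta_mem_frobeniusFibre_pFlat`). This
settles, for `t = p♭`, the primality that `Joshi/WittPrimitiveAnsatzFrobeniusOrbit.lean` refers to the claim-`Prop` `Prop621PrimeClaim`, and
says WHICH parameter is canonical: the one whose ideal is `ker θ` (residue ring `𝒪_{ℂ_F}`). [claim: Joshi2023ATS2Local, status: disputed] -/
theorem isPrime_of_mem_frobeniusFibre_pFlat {I : Ideal (Ainf (p := p) F)}
    (hI : I ∈ frobeniusFibre p (pFlat : PreTilt (integerC F) p)) : I.IsPrime := by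
  obtain ⟨n, rfl⟩ := hI
  exact isPrime_span_teichSubP_frobeniusEquiv_zpow_pFlat n

/-- `ker θ ∈ {([φⁿ(p♭)] − p) : n ∈ ℤ}` (the member `n = 0`). [claim: Joshi2023ATS2Local, status: disputed] -/
theorem ker_fontaineTheta_mem_frobeniusFibre_pFlat :
    RingHom.ker (fontaineTheta (integerC F) p) ∈ frobeniusFibre p (pFlat : PreTilt (integerC F) p) :=
  ⟨0, by simp only [zpow_zero, RingAut.one_apply, teichSubP_pFlat, ker_fontaineTheta_eq_span_xi]⟩

/-- **Prop. 6.2.1 (2) primality at the tuple entries `j = p^m` of `a = p♭`**: `𝔭_{p^m}(p♭) = (φ^{2m}(ξ))` is prime.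
[claim: Joshi2023ATS2Local, status: disputed] -/
theorem isPrime_jIdeal_pFlat_of_eq_pow {lstar m : ℕ} (i : Fin lstar) (hi : (i : ℕ) + 1 = p ^ m) :
    (jIdeal p lstar (pFlat : PreTilt (integerC F) p) i).IsPrime := by
  rw [jIdeal_eq_span_frobenius_iterate p lstar _ i hi, teichSubP_pFlat]; exact isPrime_span_frobenius_iterate_xi _

/-- **An element of `ker θ` whose first Witt coordinate is a unit generates `ker θ`** (`x = w·ξ` by `ker θ = (ξ)`, and `w` is a
unit by `isUnit_of_isUnit_mul_xi_coeff_one`). [cite: FontaineAsterisque223III, Exp. II Prop. 1.2.3] -/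
theorem span_eq_ker_of_isUnit_coeff_one {x : Ainf (p := p) F} (hx : x ∈ RingHom.ker (fontaineTheta (integerC F) p))
    (h1 : IsUnit (x.coeff 1)) : Ideal.span {x} = RingHom.ker (fontaineTheta (integerC F) p) := by
  rw [ker_fontaineTheta_eq_span_xi] at hx ⊢
  obtain ⟨w, rfl⟩ := Ideal.mem_span_singleton'.1 hx
  exact Ideal.span_singleton_mul_left_unit (isUnit_of_isUnit_mul_xi_coeff_one h1) _

/-- **Lemma 6.2.2 DISCHARGED ON `ker θ`** (p. 15 l. 15–26): every primitive element of degree one `x ∈ 𝕎(𝒪_{ℂ_F}♭)` lying over the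
standard untilt (`θ(x) = 0`) generates `𝔭_1` of the tuple of `a = p♭`, and `p♭ ∈ 𝔪` is forced (`x₀ = w₀·p♭` with `w₀` a unit) — the
BODY of `Witt.Lem622 p 𝔪 ℓ⋆` for these `x`, for ANY ideal `𝔪`. Primitive elements with `θ(x) ≠ 0` define OTHER untilts
([FF18, Cor. 2.2.9]) and stay under the hypothesis binder of `Witt.lem622_of_cor229`. [claim: Joshi2023ATS2Local, status: disputed] -/
theorem lem622_of_mem_ker_fontaineTheta (𝔪 : Ideal (PreTilt (integerC F) p)) {lstar : ℕ} (hl : 0 < lstar)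
    {x : Ainf (p := p) F} (hx : x ∈ RingHom.ker (fontaineTheta (integerC F) p)) (hprim : IsPrimitiveDegOne p 𝔪 x) :
    ∃ a : PreTilt (integerC F) p, a ≠ 0 ∧ a ∈ 𝔪 ∧ Ideal.span {x} = jIdeal p lstar a ⟨0, hl⟩ := by
  refine ⟨pFlat, pFlat_ne_zero, ?_, ?_⟩
  · have hx' := hx
    rw [ker_fontaineTheta_eq_span_xi] at hx'
    obtain ⟨w, rfl⟩ := Ideal.mem_span_singleton'.1 hx'
    obtain ⟨u, hu⟩ := isUnit_coeff_zero_of_isUnit_mul_xi_coeff_one hprim.2.2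
    have h0 : (w * xi).coeff 0 = (u : PreTilt (integerC F) p) * pFlat := by
      rw [WittVector.mul_coeff_zero, hu, ← constantCoeff_apply xi, constantCoeff_xi]
    have hmem : ((u⁻¹ : (PreTilt (integerC F) p)ˣ) : PreTilt (integerC F) p) * (w * xi).coeff 0 ∈ 𝔪 :=
      𝔪.mul_mem_left _ hprim.2.1
    rwa [h0, ← mul_assoc, Units.inv_mul, one_mul] at hmem
  · rw [jIdeal_pFlat_zero_eq_ker hl]; exact span_eq_ker_of_isUnit_coeff_one hx hprim.2.2

end StandardPoint

end Summit.ABC.IUTFork.Joshi.Witt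

end
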